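import Literature.AnabelianGeometry.EtaleTheta.Discharge.Sec2MonoThetaAutLift
import Literature.AnabelianGeometry.EtaleTheta.Discharge.Sec2ShiftNormalizesDY
import Literature.AnabelianGeometry.EtaleTheta.Discharge.Sec2TowerLemmas
import HarnessLib

/-!
# [EtTh] §2: automorphisms of `Π^tp_Y[μ_N]` over an automorphism `γ` of `Π^tp_X` — their structure, and
# what an automorphism of the model mono-theta environment `M(η)` over `γ` forces (proof-only companion)

Mochizuki, *The Étale Theta Function and its Frobenioid-theoretic Manifestations* [EtTh], Publ. RIMS
45 (2009), §2: Def 2.10 p.44, Def 2.13 (i)–(ii) pp.47–48, Prop 2.14 (ii) p.49, Cor 2.18 (iv) pp.61–63,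
Cor 2.19 (iii) p.64 (locators `p.N` = PDF pages of the PRIMS text; bib key `MochizukiEtTh2009`).
PROOF-ONLY companion (no `def`, no instance, no new named fact) of `MonoThetaEnv.lean` /
`ThetaRigidity.lean` (seat abc-iut-L2-t2; DEFS-FREEZE respected); cell abc-iut, block F, seat
abc-iut-f-147 (gen 3), FROZEN FACT-LIST row F-0625 `RigidData.Cor218_iv_surjective` (tranche 147) —
the generic half over `T : ThetaEnvData N`; the row-level theorems are in the companion
`Sec2Cor218ivSurjectiveCoreNecessity.lean`.

abc-iut-L2-t10's `Sec2AutOverProofs.lean` / `Sec2LiftingSurjProofs.lean` and abc-iut-L2-t2's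
`Sec2MonoThetaAutLift.lean` CONSTRUCT automorphisms of `Π^tp_Y[μ_N] = μ_N ⋊ Π^tp_Y` of SHAPE
`(a, g) ↦ (ψ a, γ g)` lying over a given `γ ∈ Aut_top(Π^tp_X)` with `γ(Π^tp_Y) = Π^tp_Y`. This file goes
the OTHER way and analyses an ARBITRARY automorphism `α` of `Π^tp_Y[μ_N]` lying over `γ` on the quotient
`Π^tp_Y` (`proj ∘ α = γ ∘ proj`):

* §1 `exists_mulEquiv_of_over` — `α` restricts to a COEFFICIENT AUTOMORPHISM `ψ ∈ Aut(μ_N)` of the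
  (finite) cyclotome `μ_N = Ker(Π^tp_Y[μ_N] ↠ Π^tp_Y)`; `chi_aug_apply_eq_of_over` — hence **`γ`
  preserves the cyclotomic character on `Π^tp_Y`**, `χ(aug(γ g)) = χ(aug g)` (compare the conjugation
  actions of `s^alg(g)` and of `α(s^alg(g))` on `μ_N`; `Aut(μ_N)` is commutative, `μ_N` being cyclic);
  `isEnvCocycle_left_algSection_of_over` — the `μ_N`-coordinate `φ(g) := (α(s^alg g)).left` is a
  (continuous) 1-COCYCLE of `Π^tp_Y` for `χ`; `left_apply_of_over` — **STRUCTURE**: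
  `α(a, g) = (ψ(a) · φ(g), γ g)`, i.e. `α` is a shape automorphism followed by a cocycle shift.
* §2 for `α` an automorphism of the MODEL MONO-THETA ENVIRONMENT `M(η) = (Π^tp_Y[μ_N], D_Y, [Im s^Θ_η]^μ)`
  over `γ`: `exists_apply_sTheta_eq_of_iso` (`α(s^Θ_η(d)) = ι(m) · s^Θ_η(d′) · ι(m)⁻¹`, Def 2.13 (ii)(c));
  **`apply_mem_PiYdd_of_iso_over` — `γ(Π^tp_Ÿ) ⊆ Π^tp_Ÿ` is FORCED** (project that identity to
  `Π^tp_Y`); `coeff_eta_eq_of_iso_over` / **`exists_cocycle_of_iso_over` — the constant-multiple-rigidity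
  SHAPE is FORCED up to a `Π^tp_Y`-cocycle**: `ψ(η(d)) = η(d′) · φ′(d′)` whenever `γ(d) = d′`, for a
  continuous cocycle `φ′ = (φ ∘ γ⁻¹) · (∂m)⁻¹` of `Π^tp_Y` whose shift is an automorphism of the
  topological group `Π^tp_Y[μ_N]` ([EtTh] Cor 2.19 (iii) supplies this with `φ′` inflated from `G_K`:
  hypothesis `hcoll` of abc-iut-L2-t10's `RigidData.cor218_iv_surjective_of`).

HONEST FRAMING: pure group theory / topology of the cyclotomic envelope over the typed §2 interface;
nothing of [EtTh] (refereed) is asserted or disputed; no side is taken on [IUTchIII] Cor 3.12; typed ≠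
proved; a FACT row is an assumption label, not an endorsement.
-/

noncomputable section

namespace Literature.AnabelianGeometry.EtaleTheta

universe u

namespace ThetaEnvData

variable {N : ℕ+} (T : ThetaEnvData.{u} N)

/-! ## §1. Automorphisms of `Π^tp_Y[μ_N]` lying over an automorphism `γ` of `Π^tp_X` -/

/-- Conjugating an element of the cyclotome `μ_N ⊆ Π^tp_Y[μ_N]` by `y ∈ Π^tp_Y[μ_N]` multiplies it by
the cyclotomic character of the image of `y` in `Π^tp_Y`: `y · ι(b) · y⁻¹ = ι(χ(aug ȳ) b)`.
[cite: MochizukiEtTh2009, Def 2.10 p.44] -/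
theorem mul_inMu_mul_inv (y : T.env) (b : T.mu) :
    y * CycEnvelope.inMu T.augY T.chi b * y⁻¹ =
      CycEnvelope.inMu T.augY T.chi (T.chi (T.augY y.right) b) := by
  ext
  · simp only [SemidirectProduct.mul_left, SemidirectProduct.mul_right, SemidirectProduct.inv_left,
      SemidirectProduct.left_inl, SemidirectProduct.right_inl, MonoidHom.coe_comp,
      Function.comp_apply, mul_one, map_inv]
    rw [mul_comm y.left, mul_assoc, ← MulAut.mul_apply, mul_inv_cancel, MulAut.one_apply,
      mul_inv_cancel, mul_one]
  · simp

/-- An automorphism `α` of `Π^tp_Y[μ_N]` lying over `γ ∈ Aut(Π^tp_X)` on the quotient `Π^tp_Y` kills the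
projection of the cyclotome: `proj(α(ι a)) = 1`. [cite: MochizukiEtTh2009, Cor 2.18(iv) p.61] -/
theorem proj_apply_inMu_of_over {α : MulAut T.env} {γ : T.PiX ≃ₜ* T.PiX}
    (hα : ∀ x, ((CycEnvelope.proj T.augY T.chi (α x) : T.PiY) : T.PiX) =
      γ (CycEnvelope.proj T.augY T.chi x : T.PiY)) (a : T.mu) :
    CycEnvelope.proj T.augY T.chi (α (CycEnvelope.inMu T.augY T.chi a)) = 1 := by
  apply Subtype.ext
  rw [hα]
  simp

/-- An automorphism over `γ` maps the cyclotome into the cyclotome: `α(ι a) = ι((α(ι a)).left)`.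
[cite: MochizukiEtTh2009, Cor 2.18(iv) p.61] -/
theorem apply_inMu_eq_of_over {α : MulAut T.env} {γ : T.PiX ≃ₜ* T.PiX}
    (hα : ∀ x, ((CycEnvelope.proj T.augY T.chi (α x) : T.PiY) : T.PiX) =
      γ (CycEnvelope.proj T.augY T.chi x : T.PiY)) (a : T.mu) :
    α (CycEnvelope.inMu T.augY T.chi a) =
      CycEnvelope.inMu T.augY T.chi (α (CycEnvelope.inMu T.augY T.chi a)).left := by
  have h := T.proj_apply_inMu_of_over hα a
  ext
  · simp
  · simpa using h

/-- **The coefficient automorphism `ψ ∈ Aut(μ_N)` of an automorphism over `γ`**: an automorphism `α`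
of `Π^tp_Y[μ_N]` lying over `γ` on `Π^tp_Y` restricts to a group automorphism `ψ` of the (finite)
cyclotome `μ_N = Ker(Π^tp_Y[μ_N] ↠ Π^tp_Y)`. [cite: MochizukiEtTh2009, Cor 2.18(iv) p.61] -/
theorem exists_mulEquiv_of_over {α : MulAut T.env} {γ : T.PiX ≃ₜ* T.PiX}
    (hα : ∀ x, ((CycEnvelope.proj T.augY T.chi (α x) : T.PiY) : T.PiX) =
      γ (CycEnvelope.proj T.augY T.chi x : T.PiY)) :
    ∃ ψ : T.mu ≃* T.mu, ∀ a, α (CycEnvelope.inMu T.augY T.chi a) =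
      CycEnvelope.inMu T.augY T.chi (ψ a) := by
  have hf := T.apply_inMu_eq_of_over hα
  let f : T.mu →* T.mu :=
    { toFun := fun a => (α (CycEnvelope.inMu T.augY T.chi a)).left
      map_one' := by simp
      map_mul' := fun a b => by
        have h : α (CycEnvelope.inMu T.augY T.chi (a * b)) =
            α (CycEnvelope.inMu T.augY T.chi a) * α (CycEnvelope.inMu T.augY T.chi b) := by
          rw [← map_mul, ← map_mul]
        have hr : (α (CycEnvelope.inMu T.augY T.chi a)).right = 1 := by
          simpa using T.proj_apply_inMu_of_over hα a
        rw [h, SemidirectProduct.mul_left, hr, map_one, MulAut.one_apply] }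
  have hf' : ∀ a, α (CycEnvelope.inMu T.augY T.chi a) = CycEnvelope.inMu T.augY T.chi (f a) := hf
  have hinj : Function.Injective f := by
    intro a b hab
    have h : α (CycEnvelope.inMu T.augY T.chi a) = α (CycEnvelope.inMu T.augY T.chi b) := by
      rw [hf', hf']
      exact congrArg _ hab
    exact SemidirectProduct.inl_injective (α.injective h)
  exact ⟨MulEquiv.ofBijective f hinj.bijective_of_finite, hf'⟩

/-- **An automorphism over `γ` forces `γ` to preserve the cyclotomic character on `Π^tp_Y`**:
`χ(aug(γ g)) = χ(aug g)` for every `g ∈ Π^tp_Y` — compare the conjugation action of `s^alg(g)` and of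
`α(s^alg(g))` on the cyclotome (`Aut(μ_N)` is commutative, `μ_N` being cyclic).
[cite: MochizukiEtTh2009, Cor 2.18(iv) p.61] -/
theorem chi_aug_apply_eq_of_over {α : MulAut T.env} {γ : T.PiX ≃ₜ* T.PiX}
    (hα : ∀ x, ((CycEnvelope.proj T.augY T.chi (α x) : T.PiY) : T.PiX) =
      γ (CycEnvelope.proj T.augY T.chi x : T.PiY)) (g : T.PiY) :
    T.chi (T.aug (γ (g : T.PiX))) = T.chi (T.aug (g : T.PiX)) := by
  obtain ⟨ψ, hψ⟩ := T.exists_mulEquiv_of_over hα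
  have hcomm := T.mulEquiv_comm_chi ψ
  apply MulEquiv.ext
  intro b
  obtain ⟨a, rfl⟩ := ψ.surjective b
  set y := α (CycEnvelope.algSection T.augY T.chi g) with hy
  have hyr : ((y.right : T.PiY) : T.PiX) = γ (g : T.PiX) := by
    have h := hα (CycEnvelope.algSection T.augY T.chi g)
    simpa using h
  have key := T.mul_inMu_mul_inv (CycEnvelope.algSection T.augY T.chi g) a
  simp only [SemidirectProduct.right_inr] at key
  have key' := congrArg α key
  rw [map_mul, map_mul, map_inv, hψ, hψ, ← hy, T.mul_inMu_mul_inv y (ψ a), hcomm] at key'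
  have key'' := SemidirectProduct.inl_injective key'
  -- `χ(aug ȳ) (ψ a) = χ(aug g) (ψ a)` with `ȳ = γ g`
  have haug : T.augY y.right = T.aug (γ (g : T.PiX)) := by
    rw [← hyr]; rfl
  rw [haug] at key''
  rw [key'']
  rfl

/-- **The `Π^tp_Y`-cocycle of an automorphism over `γ`**: for `α` over `γ`, the `μ_N`-coordinate
`φ(g) := (α(s^alg g)).left` of the image of the tautological section is a 1-cocycle of `Π^tp_Y` for the
cyclotomic character (because `γ` preserves `χ ∘ aug` on `Π^tp_Y`).
[cite: MochizukiEtTh2009, Prop 2.14(ii) p.49] -/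
theorem isEnvCocycle_left_algSection_of_over {α : MulAut T.env} {γ : T.PiX ≃ₜ* T.PiX}
    (hα : ∀ x, ((CycEnvelope.proj T.augY T.chi (α x) : T.PiY) : T.PiX) =
      γ (CycEnvelope.proj T.augY T.chi x : T.PiY)) :
    CycEnvelope.IsEnvCocycle T.augY T.chi
      (fun g : T.PiY => (α (CycEnvelope.algSection T.augY T.chi g)).left) := by
  intro g h
  change (α (CycEnvelope.algSection T.augY T.chi (g * h))).left =
    (α (CycEnvelope.algSection T.augY T.chi g)).left *
      T.chi (T.augY g) (α (CycEnvelope.algSection T.augY T.chi h)).left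
  have hyr : (((α (CycEnvelope.algSection T.augY T.chi g)).right : T.PiY) : T.PiX) = γ (g : T.PiX) := by
    simpa using hα (CycEnvelope.algSection T.augY T.chi g)
  have hχ : (T.chi.comp T.augY) (α (CycEnvelope.algSection T.augY T.chi g)).right =
      T.chi (T.augY g) := by
    change T.chi (T.aug (((α (CycEnvelope.algSection T.augY T.chi g)).right : T.PiY) : T.PiX)) =
      T.chi (T.aug (g : T.PiX))
    rw [hyr, T.chi_aug_apply_eq_of_over hα g]
  rw [map_mul, map_mul, SemidirectProduct.mul_left, hχ]

/-- The cocycle `g ↦ (α(s^alg g)).left` of a CONTINUOUS `α` is continuous.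
[cite: MochizukiEtTh2009, Prop 2.14(ii) p.49] -/
theorem continuous_left_algSection {α : MulAut T.env} (hc : Continuous α) :
    Continuous fun g : T.PiY => (α (CycEnvelope.algSection T.augY T.chi g)).left :=
  T.continuous_left.comp (hc.comp T.continuous_algSection)

/-- **SHAPE of an automorphism over `γ`**: if `α` lies over `γ` on `Π^tp_Y` and acts on the cyclotome by
`ψ`, then `α(a, g) = (ψ(a) · φ(g), γ g)` with `φ(g) = (α(s^alg g)).left` — every automorphism over `γ`
is the "shape" automorphism `(a, g) ↦ (ψ a, γ g)` of `Sec2AutOverProofs` followed by the shift by the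
cocycle `φ ∘ γ⁻¹`. [cite: MochizukiEtTh2009, Cor 2.18(iv) p.61] -/
theorem left_apply_of_over {α : MulAut T.env} (ψ : T.mu ≃* T.mu)
    (hψ : ∀ a, α (CycEnvelope.inMu T.augY T.chi a) = CycEnvelope.inMu T.augY T.chi (ψ a))
    (x : T.env) :
    (α x).left = ψ x.left * (α (CycEnvelope.algSection T.augY T.chi x.right)).left := by
  conv_lhs => rw [← CycEnvelope.inMu_mul_algSection T.augY T.chi x]
  rw [map_mul, hψ]
  simp only [SemidirectProduct.mul_left, SemidirectProduct.left_inl, SemidirectProduct.right_inl,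
    map_one, MulAut.one_apply]

/-! ## §2. Automorphisms of the model mono-theta environment `M(η)` over `γ` -/

/-- An automorphism of the model mono-theta environment `M(η)` carries `Im(s^Θ_η)` onto a
`μ_N`-conjugate of itself (Def 2.13 (ii) (c): the datum is the `μ_N`-conjugacy CLASS of `Im(s^Θ_η)`).
[cite: MochizukiEtTh2009, Def 2.13(ii) p.47] -/
theorem exists_map_range_sTheta_eq_of_iso {η : T.PiYdd → T.mu} (hη : η ∈ T.thetaCocycles)
    (α : (T.modelMono hη).Iso (T.modelMono hη)) :
    ∃ m : T.mu, (T.sTheta hη).range.map α.e.toMulEquiv.toMonoidHom =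
      (T.sTheta hη).range.map (MulAut.conj (CycEnvelope.inMu T.augY T.chi m)).toMonoidHom := by
  have h := α.map_sTheta
  change (fun H : Subgroup T.env => H.map α.e.toMulEquiv.toMonoidHom) ''
      CycEnvelope.muConjClass T.augY T.chi (T.sTheta hη).range =
    CycEnvelope.muConjClass T.augY T.chi (T.sTheta hη).range at h
  have hmem : (T.sTheta hη).range.map α.e.toMulEquiv.toMonoidHom ∈
      CycEnvelope.muConjClass T.augY T.chi (T.sTheta hη).range := by
    rw [← h]
    exact ⟨_, CycEnvelope.self_mem_muConjClass _ _ _, rfl⟩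
  obtain ⟨m, hm⟩ := hmem
  exact ⟨m, hm⟩

/-- Pointwise form: for some `m ∈ μ_N`, every `α(s^Θ_η(d))` is `ι(m) · s^Θ_η(d′) · ι(m)⁻¹` for some
`d′ ∈ Π^tp_Ÿ`. [cite: MochizukiEtTh2009, Def 2.13(ii) p.47] -/
theorem exists_apply_sTheta_eq_of_iso {η : T.PiYdd → T.mu} (hη : η ∈ T.thetaCocycles)
    (α : (T.modelMono hη).Iso (T.modelMono hη)) :
    ∃ m : T.mu, ∀ d : T.PiYdd, ∃ d' : T.PiYdd,
      α.e (T.sTheta hη d) =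
        MulAut.conj (CycEnvelope.inMu T.augY T.chi m) (T.sTheta hη d') := by
  obtain ⟨m, hm⟩ := T.exists_map_range_sTheta_eq_of_iso hη α
  refine ⟨m, fun d => ?_⟩
  have hd : α.e (T.sTheta hη d) ∈
      (T.sTheta hη).range.map (MulAut.conj (CycEnvelope.inMu T.augY T.chi m)).toMonoidHom := by
    rw [← hm]
    exact ⟨T.sTheta hη d, ⟨d, rfl⟩, rfl⟩
  obtain ⟨_, ⟨d', rfl⟩, hd'⟩ := hd
  exact ⟨d', hd'.symm⟩

/-- The quotient map kills `μ_N`-conjugation: `proj(ι(m) · s^Θ_η(d′) · ι(m)⁻¹) = d′`.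
[cite: MochizukiEtTh2009, Def 2.13(ii) p.47] -/
theorem proj_conj_inMu_sTheta {η : T.PiYdd → T.mu} (hη : η ∈ T.thetaCocycles) (m : T.mu)
    (d' : T.PiYdd) :
    CycEnvelope.proj T.augY T.chi (MulAut.conj (CycEnvelope.inMu T.augY T.chi m) (T.sTheta hη d')) =
      T.inclYdd d' := by
  rw [MulAut.conj_apply, map_mul, map_mul, map_inv]
  simp [ThetaEnvData.sTheta]

/-- **An automorphism of `M(η)` over `γ` forces `γ(Π^tp_Ÿ) ⊆ Π^tp_Ÿ`**: `γ(d) = proj(α(s^Θ_η(d)))` and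
`α(s^Θ_η(d))` is a `μ_N`-conjugate of some `s^Θ_η(d′)`, whose projection `d′` lies in `Π^tp_Ÿ`.
(The `Π^tp_Ÿ`-clause of Cor 2.18 (i), for `Π^tp_Y`-preserving `γ`, is thus NECESSARY for Cor 2.18 (iv).)
[cite: MochizukiEtTh2009, Cor 2.18(iv) p.61] -/
theorem apply_mem_PiYdd_of_iso_over {η : T.PiYdd → T.mu} (hη : η ∈ T.thetaCocycles)
    (α : (T.modelMono hη).Iso (T.modelMono hη)) {γ : T.PiX ≃ₜ* T.PiX}
    (hα : ∀ x, ((CycEnvelope.proj T.augY T.chi (α.e x) : T.PiY) : T.PiX) =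
      γ (CycEnvelope.proj T.augY T.chi x : T.PiY)) (d : T.PiYdd) :
    γ (d : T.PiX) ∈ T.PiYdd := by
  obtain ⟨m, hm⟩ := T.exists_apply_sTheta_eq_of_iso hη α
  obtain ⟨d', hd'⟩ := hm d
  have h1 : ((CycEnvelope.proj T.augY T.chi (α.e (T.sTheta hη d)) : T.PiY) : T.PiX) = γ (d : T.PiX) := by
    rw [hα]; rfl
  rw [← h1, hd', T.proj_conj_inMu_sTheta hη m d']
  exact d'.2

/-- **The coefficient identity forced by an automorphism of `M(η)` over `γ`** (source form): with `ψ`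
the coefficient automorphism, `φ(g) = (α(s^alg g)).left` the `Π^tp_Y`-cocycle of `α` and `m ∈ μ_N` the
`μ_N`-offset of `Im(s^Θ_η)`, one has `ψ(η(d)) = η(d′) · φ(d) · (∂m)(d′)⁻¹` whenever `γ(d) = d′`
(`∂m(g) = m · (χ(g) m)⁻¹` the coboundary of `m`). [cite: MochizukiEtTh2009, Cor 2.19(iii) p.64] -/
theorem coeff_eta_eq_of_iso_over {η : T.PiYdd → T.mu} (hη : η ∈ T.thetaCocycles)
    (α : (T.modelMono hη).Iso (T.modelMono hη)) {γ : T.PiX ≃ₜ* T.PiX}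
    (hα : ∀ x, ((CycEnvelope.proj T.augY T.chi (α.e x) : T.PiY) : T.PiX) =
      γ (CycEnvelope.proj T.augY T.chi x : T.PiY))
    (ψ : T.mu ≃* T.mu)
    (hψ : ∀ a, α.e (CycEnvelope.inMu T.augY T.chi a) = CycEnvelope.inMu T.augY T.chi (ψ a)) :
    ∃ m : T.mu, ∀ d d' : T.PiYdd, γ (d : T.PiX) = d' →
      ψ (η d) = η d' * (α.e (CycEnvelope.algSection T.augY T.chi (T.inclYdd d))).left *
        (CycEnvelope.coboundary T.augY T.chi m (T.inclYdd d'))⁻¹ := by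
  obtain ⟨m, hm⟩ := T.exists_apply_sTheta_eq_of_iso hη α
  refine ⟨m, fun d d' hdd' => ?_⟩
  obtain ⟨d'', hd''⟩ := hm d
  -- `d'' = d'`: compare projections
  have h1 : ((CycEnvelope.proj T.augY T.chi (α.e (T.sTheta hη d)) : T.PiY) : T.PiX) = γ (d : T.PiX) := by
    rw [hα]; rfl
  have hd''eq : d'' = d' := by
    apply Subtype.ext
    rw [← hdd', ← h1, hd'', T.proj_conj_inMu_sTheta hη m d'']
    rfl
  subst hd''eq
  -- compare the `μ_N`-coordinates of `α(s^Θ(d)) = ι(m) s^Θ(d'') ι(m)⁻¹`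
  let A : MulAut T.env := α.e.toMulEquiv
  have hA : ∀ x, α.e x = A x := fun _ => rfl
  have hleft := T.left_apply_of_over (α := A) ψ hψ (T.sTheta hη d)
  rw [← hA, hd''] at hleft
  have lhs : (MulAut.conj (CycEnvelope.inMu T.augY T.chi m) (T.sTheta hη d'')).left =
      m * (η d'')⁻¹ * (T.chi (T.augY (T.inclYdd d'')) m)⁻¹ := by
    rw [MulAut.conj_apply]
    simp only [ThetaEnvData.sTheta, SemidirectProduct.mul_left, SemidirectProduct.mul_right,
      SemidirectProduct.inv_left, SemidirectProduct.left_inl, SemidirectProduct.right_inl,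
      MonoidHom.coe_mk, OneHom.coe_mk, MonoidHom.coe_comp, Function.comp_apply, map_one,
      MulAut.one_apply, one_mul, inv_one, map_inv]
  have rhs : (T.sTheta hη d).left = (η d)⁻¹ ∧ (T.sTheta hη d).right = T.inclYdd d := ⟨rfl, rfl⟩
  rw [lhs, rhs.1, rhs.2, map_inv] at hleft
  -- solve for `ψ (η d)` in the commutative group `μ_N`
  have key : ∀ X E M C Φ : T.mu, M * E⁻¹ * C⁻¹ = X⁻¹ * Φ → X = E * Φ * (M * C⁻¹)⁻¹ := by
    intro X E M C Φ h
    have h' : Φ = X * (M * E⁻¹ * C⁻¹) := by rw [h, mul_inv_cancel_left]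
    rw [h']
    apply Additive.ofMul.injective
    simp only [ofMul_mul, ofMul_inv]
    abel
  simp only [CycEnvelope.coboundary]
  rw [hA]
  exact key _ _ _ _ _ hleft

/-- **What an automorphism of `M(η)` over `γ` FORCES on the theta collection** (target form; the shape
of constant multiple rigidity, [EtTh] Cor 2.19 (iii), up to a `Π^tp_Y`-cocycle): there are a
coefficient automorphism `ψ ∈ Aut(μ_N)` and a CONTINUOUS 1-cocycle `φ` of `Π^tp_Y` for the cyclotomic
character (so that the shift `α_φ` is an automorphism of the topological group `Π^tp_Y[μ_N]`) with
`ψ(η(d)) = η(d′) · φ(d′)` whenever `γ(d) = d′` — i.e. `ψ ∘ η = (η · φ|_{Π^tp_Ÿ}) ∘ γ` on `Π^tp_Ÿ`.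
(`φ = (φ₀ ∘ γ⁻¹) · (∂m)⁻¹` with `φ₀` the cocycle of `α` and `m` the `μ_N`-offset.) The route of record
(`RigidData.cor218_iv_surjective_of`, hypothesis `hcoll`) supplies this with `φ` INFLATED from `G_K`.
[cite: MochizukiEtTh2009, Cor 2.19(iii) p.64] -/
theorem exists_cocycle_of_iso_over {η : T.PiYdd → T.mu} (hη : η ∈ T.thetaCocycles)
    (α : (T.modelMono hη).Iso (T.modelMono hη)) {γ : T.PiX ≃ₜ* T.PiX}
    (hY : T.PiY.map γ.toMulEquiv.toMonoidHom = T.PiY)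
    (hα : ∀ x, ((CycEnvelope.proj T.augY T.chi (α.e x) : T.PiY) : T.PiX) =
      γ (CycEnvelope.proj T.augY T.chi x : T.PiY)) :
    ∃ (ψ : T.mu ≃* T.mu) (φ : T.PiY → T.mu) (hφ : CycEnvelope.IsEnvCocycle T.augY T.chi φ),
      Continuous φ ∧ CycEnvelope.shift hφ ∈ contMulAut T.env ∧
      (∀ a, α.e (CycEnvelope.inMu T.augY T.chi a) = CycEnvelope.inMu T.augY T.chi (ψ a)) ∧
      ∀ d d' : T.PiYdd, γ (d : T.PiX) = d' → ψ (η d) = η d' * φ (T.inclYdd d') := by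
  let A : MulAut T.env := α.e.toMulEquiv
  have hA : ∀ x, α.e x = A x := fun _ => rfl
  obtain ⟨ψ, hψ⟩ := T.exists_mulEquiv_of_over (α := A) hα
  obtain ⟨m, hm⟩ := T.coeff_eta_eq_of_iso_over hη α hα ψ hψ
  obtain ⟨-, hYm'⟩ := T.mem_and_symm_mem_of_map_eq γ _ hY
  -- `γ⁻¹` on `Π^tp_Y`
  let ginv : T.PiY → T.PiY := fun g => ⟨γ.symm (g : T.PiX), hYm' _ g.2⟩
  have hginv_mul : ∀ g h, ginv (g * h) = ginv g * ginv h := fun g h =>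
    Subtype.ext (by simp [ginv])
  have hginv_cont : Continuous ginv :=
    (γ.symm.continuous.comp continuous_subtype_val).subtype_mk _
  have hγginv : ∀ g : T.PiY, γ ((ginv g : T.PiY) : T.PiX) = g := fun g => γ.apply_symm_apply _
  -- the cocycle of `α` and its transport by `γ⁻¹`, corrected by the coboundary of `m`
  let φ₀ : T.PiY → T.mu := fun g => (A (CycEnvelope.algSection T.augY T.chi g)).left
  have hφ₀ : CycEnvelope.IsEnvCocycle T.augY T.chi φ₀ := T.isEnvCocycle_left_algSection_of_over hα
  have hφ₁ : CycEnvelope.IsEnvCocycle T.augY T.chi (φ₀ ∘ ginv) := by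
    intro g h
    change φ₀ (ginv (g * h)) = φ₀ (ginv g) * T.chi (T.augY g) (φ₀ (ginv h))
    rw [hginv_mul, hφ₀]
    have hχ : T.chi (T.augY (ginv g)) = T.chi (T.augY g) := by
      have h := T.chi_aug_apply_eq_of_over hα (ginv g)
      rw [hγginv] at h
      exact h.symm
    rw [hχ]
  have hφ : CycEnvelope.IsEnvCocycle T.augY T.chi
      ((φ₀ ∘ ginv) * (CycEnvelope.coboundary T.augY T.chi m)⁻¹) :=
    hφ₁.mul (CycEnvelope.isEnvCocycle_coboundary T.augY T.chi m).inv
  have hcob : Continuous (CycEnvelope.coboundary T.augY T.chi m) := by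
    change Continuous fun g : T.PiY => m * (T.chi (T.augY g) m)⁻¹
    exact continuous_const.mul (T.continuous_chi_augY_apply m).inv
  have hφc : Continuous ((φ₀ ∘ ginv) * (CycEnvelope.coboundary T.augY T.chi m)⁻¹) :=
    ((T.continuous_left_algSection α.e.continuous).comp hginv_cont).mul hcob.inv
  refine ⟨ψ, _, hφ, hφc, T.shift_mem_contMulAut_of_continuous hφ hφc, hψ, fun d d' hdd' => ?_⟩
  have hg : ginv (T.inclYdd d') = T.inclYdd d := by
    apply Subtype.ext
    change γ.symm ((d' : T.PiX)) = (d : T.PiX)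
    rw [← hdd', γ.symm_apply_apply]
  rw [hm d d' hdd', Pi.mul_apply, Pi.inv_apply, Function.comp_apply, hg, mul_assoc]
  rfl

end ThetaEnvData

end Literature.AnabelianGeometry.EtaleTheta

end
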